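import Literature.Barriers.HodgeConjecture.HodgeLocusAlgebraicOverCurve
import Literature.AlgebraicGeometry.HodgeTheory.VHSDataSubHodgeStructureTranslateLocus
import Literature.AlgebraicGeometry.Motives.FamiliesVHSExteriorPower
import Literature.AlgebraicGeometry.HodgeTheory.VHSDataSubHodgeStructureTranslateLocusExteriorPower
import HarnessLib

/-!
# The Cattani–Deligne–Kaplan barrier property HOLDS over a punctured compact curve: Theorem 1.1 / Cor. 1.2 / Cor. 1.3 / Cor. 1.4
# (`r = 1`) delivered as Zariski closedness on points, the open ends and the compact core supplied by the compactification

[topic Barriers/HodgeConjecture]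

Topic `Literature/Barriers/HodgeConjecture` (namespace `Literature.Barriers.HodgeConjecture`), lane `lit-hodgefound` (seat `p08`, rows
g55-#6 and g55-#12 (§4)).  THEOREMS ONLY: no definition, NO new named fact (the barrier `CattaniDeligneKaplan1995_hodgeLocus_algebraicFor` is the tree's,
`Barriers/HodgeConjecture/HodgeLocusAlgebraic`), no instance (D-0026 net debt `0`).  SIBLING of
`Barriers/HodgeConjecture/HodgeLocusAlgebraicOverCurve.lean` §3 and §6, whose closed forms `…_of_charts`, `…_of_lift`,
`isZariskiClosedOnPoints_determinationLocus_of_charts` carry the abstract topological hypotheses «open ends `σᵢ{Im z > A}`» and «compact core»;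
here they are DISCHARGED by the model of `Topology/PuncturedChartEnds` ∕ `HodgeTheory/VHSDataHodgeLocusOverPuncturedCompactCurve`: the
complex points `S(ℂ)` EMBEDDED (`j`) in a COMPACT space `X` (the smooth compactification `S̄(ℂ)`), the complement consisting of chart centres
`pt i` of disc charts `φ i : OpenPartialHomeomorph X ℂ` (`φ i (pt i) = 0`, `D(e^{−2πA₀ i}) ⊆` target), the local period charts at the punctures
uniformised by `σ i` with `j (σ i z) = (φ i)⁻¹(e^{2πiz})` (`Im z > A₀ i`).

PRINTED SOURCE, VERBATIM (E. Cattani, P. Deligne, A. Kaplan, *On the locus of Hodge classes*, J. AMS 8 (1995); held text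
`paper:arxiv-alg-geom_9402009`): «**Theorem 1.1.** `S^{(K)}` is an algebraic variety, finite over `S`.» «**Corollary 1.3.** Let `u` be a section of
the local system `𝒱_ℤ` on a universal covering of `S`. The set of points in `S` where some determination of `u` is of type `(0,0)`, is an algebraic
subvariety of `S`.» «**Corollary 1.4.** … fix `s ∈ S` and let `U_ℚ ⊂ (𝒱_s)_ℚ` be a rational subspace. The locus where some flat translate of `U_ℚ`
is a Hodge substructure is an algebraic subvariety of `S`. *Proof*: … suppose first that `U_ℚ` is of dimension one. … Let `e` be a generator of
`U_ℚ ∩ 𝒱_ℤ`. Then `U_ℚ` is a Hodge substructure if and only if `e` is of type `(0,0)`, and one applies 1.3.» (pp. 484–486); «Proof of 1.5 ⟹ 1.1: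
… Let `S̄` be a smooth compactification of `S` … in a neighborhood of any point in `S̄ − S`, one is in the situation considered in 1.5 … By
GAGA, `S̄^{(K)}`, finite over `S̄`, is algebraic, and 1.1 follows.» (p. 485).

* §1 **`CattaniDeligneKaplan1995_hodgeLocus_algebraicFor_of_charts_of_compactification`** ∕ **`…_of_lift_of_compactification`** — THM 1.1 ∕ COR 1.2
  (`r = 1`): for `D : GeometricVHSData B f n (2p)` over `S(ℂ)` preconnected, `S` locally of finite type over `ℂ`, with the interior period charts
  (flat with a metric comparison, resp. holomorphic lifts) and the unipotent puncture charts of the tree's one-variable theorem, and the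
  compactification model above: **`CattaniDeligneKaplan1995_hodgeLocus_algebraicFor B D` holds** (every Hodge locus of bounded norm is `Z_K(ℂ)`,
  `Z_K ⊆ S` Zariski closed).
* §2 **`isZariskiClosedOnPoints_determinationLocus_of_compactification`** — COR 1.3 (`r = 1`): the locus where SOME determination of an integral
  class `u₀` is of type `(p,p)` is Zariski closed on points.
* §3 **`isZariskiClosedOnPoints_translateLocus_line_of_compactification`** — COR 1.4 for a rational LINE `ℚ · u₀` (`r = 1`): the locus where some
  flat translate of `ℚ · u₀` is a sub-Hodge structure is Zariski closed on points (it IS the determination locus of `u₀`: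
  `HodgeTheory/VHSDataSubHodgeStructureTranslateLocus`; the rational fibres of every VHS datum are finite dimensional:
  `VHSData.finite_fiber` of `Motives/FamiliesVHSExteriorPower`).

* §4 **`isZariskiClosedOnPoints_translateLocus_of_compactification`** — COR 1.4 for a rational subspace of ANY dimension `d` (`r = 1`): with the
  charts of Cor. 1.3 FOR THE EXTERIOR-POWER DATUM `⋀ᵈ D`, the locus where some flat translate of `U` is a sub-Hodge structure is Zariski closed on
  points (`HodgeTheory/VHSDataSubHodgeStructureTranslateLocusExteriorPower`: it is the determination locus of an integral `m₁ ∧ ⋯ ∧ m_d`).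

HONEST SCOPE (as in the sibling): `dim S = 1` only; the charts (holomorphy, Schmid's nilpotent orbit theorem, unipotent local monodromy) and the
compactification with disc charts are HYPOTHESES on `D` and `S(ℂ)`; Cor. 1.4 for `dim U_ℚ = d` arbitrary goes through the exterior-power variation `⋀ᵈ D` (`VHSData.exteriorPower`), whose
period charts are then the hypotheses (§4).
HC ∕ HC_CM are not touched.

## References

* [CattaniDeligneKaplan1995] E. Cattani, P. Deligne, A. Kaplan, *On the locus of Hodge classes*, J. Amer. Math. Soc. 8 (1995) 483–506: Thm. 1.1,
  Cor. 1.2, Cor. 1.3, Cor. 1.4 (pp. 484–486), «Proof of 1.5 ⟹ 1.1» (p. 485), 2.3 (p. 487).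
* [Hartshorne1977] R. Hartshorne, *Algebraic Geometry* (1977), Ch. II Ex. 3.14 (closed points of a scheme of finite type over a field).
-/

noncomputable section

open scoped TensorProduct ComplexOrder
open _root_.Topology _root_.Filter Set
open AlgebraicGeometry

namespace Literature.Barriers.HodgeConjecture

open Literature.AlgebraicGeometry Literature.AlgebraicGeometry.Motives Literature.AlgebraicGeometry.HodgeTheory
open Literature.AlgebraicGeometry.Motives.HodgeStructure (ofRat)

universe u

variable {B : BettiHodgeData ℂ} {𝒳 S : SchemeOver ℂ} {f : 𝒳 ⟶ S} {n p : ℕ}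
variable {V : Type u} [AddCommGroup V] [Module ℚ V] [FiniteDimensional ℚ V]
variable {X : Type*} [TopologicalSpace X] [CompactSpace X]

/-! ## §1 Theorem 1.1 / Corollary 1.2 (`r = 1`) over a punctured compact curve, as the barrier property -/

/-- **Cattani–Deligne–Kaplan, THEOREM 1.1 / COROLLARY 1.2 for `r = 1` over a PUNCTURED COMPACT CURVE, delivered as the barrier property.**
`D : GeometricVHSData B f n (2p)` over `S(ℂ)` preconnected, `S` locally of finite type over `ℂ`; FLAT INTERIOR CHARTS with a uniform Hodge-metric
comparison at every complex point and UNIPOTENT PUNCTURE CHARTS `Lᵢ, Γᵢ, Λᵢ, σᵢ, eᵢ, A₀ᵢ` exactly as in the sibling's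
`CattaniDeligneKaplan1995_hodgeLocus_algebraicFor_of_charts`; and, in place of its abstract «open ends ∕ compact core», THE COMPACTIFICATION: an
embedding `j : S(ℂ) → X` into a compact `X` whose complement consists of the centres `pt i ∉ j(S(ℂ))` of disc charts `φ i` (`φ i (pt i) = 0`,
`D(e^{−2πA₀ i}) ⊆ (φ i).target`), with `j (σ i z) = (φ i)⁻¹(e^{2πiz})` for `Im z > A₀ i`.  Then **`CattaniDeligneKaplan1995_hodgeLocus_algebraicFor B D`
holds**: for every `K` the Hodge locus of norm `≤ K` is the set of complex points of a Zariski-closed subset of `S`.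
[cite: CattaniDeligneKaplan1995, Thm. 1.1, Cor. 1.2 (p. 484), «Proof of 1.5 ⟹ 1.1» (p. 485), 2.3 (p. 487)] [cite: Hartshorne1977, Ch. II Ex. 3.14] -/
theorem CattaniDeligneKaplan1995_hodgeLocus_algebraicFor_of_charts_of_compactification [PreconnectedSpace (ComplexPoints S)]
    [LocallyOfFiniteType S.hom] (D : GeometricVHSData B f n (2 * p))
    -- interior charts at every point
    (hint : ∀ x : ComplexPoints S, ∃ ψ : OpenPartialHomeomorph (ComplexPoints S) ℂ, x ∈ ψ.source ∧
      IsPreconnected ψ.target ∧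
      ∃ (e : ∀ c : ℂ, D.V.fiber (ψ.symm c) ≃ₗ[ℚ] V) (H₀ : HodgeStructure V ((2 * p : ℕ) : ℤ)) (P₀ : H₀.Polarization)
        (h : ℂ → Module.End ℂ (ℂ ⊗[ℚ] V)) (Λ₀ : Submodule ℤ V) (κ : ℝ),
        (∀ (φ : Module.Dual ℂ (ℂ ⊗[ℚ] V)) (w : ℂ ⊗[ℚ] V), AnalyticOnNhd ℂ (fun c => φ (h c w)) ψ.target) ∧
        (∀ c ∈ ψ.target, ((D.hodge (ψ.symm c)).F (p : ℤ)).map ((e c).toLinearMap.baseChange ℂ) =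
          (H₀.F (p : ℤ)).comap (h c)) ∧
        (∀ c ∈ ψ.target, ∀ x y : D.V.fiber (ψ.symm c), (D.form (ψ.symm c)).form x y = P₀.form (e c x) (e c y)) ∧
        Λ₀.FG ∧ (∀ c ∈ ψ.target, ∀ u : D.VZ.fiber (ψ.symm c), e c (D.toRat (ψ.symm c) u) ∈ Λ₀) ∧
        (∀ c ∈ ψ.target, ∀ v ∈ Λ₀, ∃ u : D.VZ.fiber (ψ.symm c), e c (D.toRat (ψ.symm c) u) = v) ∧
        0 < κ ∧ (∀ c ∈ ψ.target, ∀ x : D.V.fiber (ψ.symm c),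
          κ * P₀.hodgeNorm (ofRat (e c x)) ≤ (D.form (ψ.symm c)).hodgeNorm (ofRat x)))
    -- puncture charts
    {ι : Type*} (L : ι → PolarizedLimitMixedHodgeStructure V ((2 * p : ℕ) : ℤ))
    (Γ : ι → ℂ → Module.End ℂ (ℂ ⊗[ℚ] V)) (hΓ0 : ∀ i, Γ i 0 = 0)
    (hΓan : ∀ (i : ι) (φ : Module.Dual ℂ (ℂ ⊗[ℚ] V)) (w : ℂ ⊗[ℚ] V), AnalyticAt ℂ (fun s => φ (Γ i s w)) 0)
    (hΓb : ∀ (i : ι) (s : ℂ), Γ i s ∈ ⨆ ab ∈ {ab : ℤ × ℤ | ab.1 ≤ -1}, (L i).toMixedHodgeStructure.endPiece ab.1 ab.2)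
    (Λ : ι → Submodule ℤ V) (hΛ : ∀ i, (Λ i).FG) (hΛT : ∀ i, ∀ u ∈ Λ i, (L i).monodromy u ∈ Λ i)
    (σ : ι → ℂ → ComplexPoints S) (e : ∀ (i : ι) (z : ℂ), D.V.fiber (σ i z) ≃ₗ[ℚ] V) (A₀ : ι → ℝ)
    (hF : ∀ (i : ι) (z : ℂ), A₀ i ≤ z.im → ((D.hodge (σ i z)).F (p : ℤ)).map ((e i z).toLinearMap.baseChange ℂ) =
      (((L i).F (p : ℤ)).map (IsNilpotent.exp (Γ i (Complex.exp (2 * Real.pi * Complex.I * z))))).map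
        (IsNilpotent.exp (z • (L i).N.baseChange ℂ)))
    (hQ : ∀ (i : ι) (z : ℂ), A₀ i ≤ z.im → ∀ x y : D.V.fiber (σ i z), (D.form (σ i z)).form x y = (L i).Q (e i z x) (e i z y))
    (hΛ₁ : ∀ (i : ι) (z : ℂ), A₀ i ≤ z.im → ∀ u : D.VZ.fiber (σ i z), e i z (D.toRat (σ i z) u) ∈ Λ i)
    (hΛ₂ : ∀ (i : ι) (z : ℂ), A₀ i ≤ z.im → ∀ v ∈ Λ i, ∃ u : D.VZ.fiber (σ i z), e i z (D.toRat (σ i z) u) = v)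
    -- the compactification with disc charts at the punctures
    {j : ComplexPoints S → X} (hj : IsEmbedding j) (pt : ι → X) (hpS : ∀ i, pt i ∉ range j)
    (hcov : ∀ x : X, x ∉ range j → ∃ i, x = pt i) (φ : ι → OpenPartialHomeomorph X ℂ) (hp : ∀ i, pt i ∈ (φ i).source)
    (hφp : ∀ i, φ i (pt i) = 0) (hball : ∀ i, Metric.ball (0 : ℂ) (Real.exp (-(2 * Real.pi * A₀ i))) ⊆ (φ i).target)
    (hσ : ∀ (i : ι) (z : ℂ), A₀ i < z.im → j (σ i z) = (φ i).symm (Complex.exp (2 * Real.pi * Complex.I * z))) :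
    CattaniDeligneKaplan1995_hodgeLocus_algebraicFor B D :=
  CattaniDeligneKaplan1995_hodgeLocus_algebraicFor_of_forall_eq_univ_or_finite D fun K =>
    D.toVHSData.hodgeLocusOfNormLe_eq_univ_or_finite_of_compactification (natCast_add_self_eq_natCast_two_mul p) K hint L Γ
      hΓ0 hΓan hΓb Λ hΛ hΛT σ e A₀ hF hQ hΛ₁ hΛ₂ hj pt hpS hcov φ hp hφp hball hσ

/-- **The same with HOLOMORPHIC-LIFT interior charts** (the sibling's `CattaniDeligneKaplan1995_hodgeLocus_algebraicFor_of_lift`, its open ends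
and compact core replaced by the compactification with disc charts at the punctures). [cite: CattaniDeligneKaplan1995, Thm. 1.1, Cor. 1.2 (p. 484), «Proof of 1.5 ⟹ 1.1» (p. 485), 2.3 (p. 487)]
[cite: Hartshorne1977, Ch. II Ex. 3.14] -/
theorem CattaniDeligneKaplan1995_hodgeLocus_algebraicFor_of_lift_of_compactification [PreconnectedSpace (ComplexPoints S)]
    [LocallyOfFiniteType S.hom] (D : GeometricVHSData B f n (2 * p))
    -- holomorphic-lift interior charts at every point
    (hint : ∀ x : ComplexPoints S, ∃ ψ : OpenPartialHomeomorph (ComplexPoints S) ℂ, x ∈ ψ.source ∧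
      ∃ (e : ∀ c : ℂ, D.V.fiber (ψ.symm c) ≃ₗ[ℚ] V) (H₀ : HodgeStructure V ((2 * p : ℕ) : ℤ)) (P₀ : H₀.Polarization)
        (g h : ℂ → Module.End ℂ (ℂ ⊗[ℚ] V)) (Λ₀ : Submodule ℤ V),
        (∀ c ∈ ψ.target, ∀ w, g c (h c w) = w) ∧ (∀ c ∈ ψ.target, ∀ w, h c (g c w) = w) ∧
        (∀ (φ : Module.Dual ℂ (ℂ ⊗[ℚ] V)) (w : ℂ ⊗[ℚ] V), AnalyticOnNhd ℂ (fun c => φ (h c w)) ψ.target) ∧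
        (∀ (w : ℂ ⊗[ℚ] V) (φ : (ℂ ⊗[ℚ] V) →ₗ[ℂ] ℂ), Tendsto (fun c => φ (g c w)) (𝓝 (ψ x)) (𝓝 (φ w))) ∧
        (∀ c ∈ ψ.target, ∀ q : ℤ, ((D.hodge (ψ.symm c)).F q).map ((e c).toLinearMap.baseChange ℂ) = (H₀.F q).map (g c)) ∧
        (∀ c ∈ ψ.target, ∀ x y : D.V.fiber (ψ.symm c), (D.form (ψ.symm c)).form x y = P₀.form (e c x) (e c y)) ∧
        Λ₀.FG ∧ (∀ c ∈ ψ.target, ∀ u : D.VZ.fiber (ψ.symm c), e c (D.toRat (ψ.symm c) u) ∈ Λ₀) ∧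
        (∀ c ∈ ψ.target, ∀ v ∈ Λ₀, ∃ u : D.VZ.fiber (ψ.symm c), e c (D.toRat (ψ.symm c) u) = v))
    -- puncture charts
    {ι : Type*} (L : ι → PolarizedLimitMixedHodgeStructure V ((2 * p : ℕ) : ℤ))
    (Γ : ι → ℂ → Module.End ℂ (ℂ ⊗[ℚ] V)) (hΓ0 : ∀ i, Γ i 0 = 0)
    (hΓan : ∀ (i : ι) (φ : Module.Dual ℂ (ℂ ⊗[ℚ] V)) (w : ℂ ⊗[ℚ] V), AnalyticAt ℂ (fun s => φ (Γ i s w)) 0)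
    (hΓb : ∀ (i : ι) (s : ℂ), Γ i s ∈ ⨆ ab ∈ {ab : ℤ × ℤ | ab.1 ≤ -1}, (L i).toMixedHodgeStructure.endPiece ab.1 ab.2)
    (Λ : ι → Submodule ℤ V) (hΛ : ∀ i, (Λ i).FG) (hΛT : ∀ i, ∀ u ∈ Λ i, (L i).monodromy u ∈ Λ i)
    (σ : ι → ℂ → ComplexPoints S) (e : ∀ (i : ι) (z : ℂ), D.V.fiber (σ i z) ≃ₗ[ℚ] V) (A₀ : ι → ℝ)
    (hF : ∀ (i : ι) (z : ℂ), A₀ i ≤ z.im → ((D.hodge (σ i z)).F (p : ℤ)).map ((e i z).toLinearMap.baseChange ℂ) =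
      (((L i).F (p : ℤ)).map (IsNilpotent.exp (Γ i (Complex.exp (2 * Real.pi * Complex.I * z))))).map
        (IsNilpotent.exp (z • (L i).N.baseChange ℂ)))
    (hQ : ∀ (i : ι) (z : ℂ), A₀ i ≤ z.im → ∀ x y : D.V.fiber (σ i z), (D.form (σ i z)).form x y = (L i).Q (e i z x) (e i z y))
    (hΛ₁ : ∀ (i : ι) (z : ℂ), A₀ i ≤ z.im → ∀ u : D.VZ.fiber (σ i z), e i z (D.toRat (σ i z) u) ∈ Λ i)
    (hΛ₂ : ∀ (i : ι) (z : ℂ), A₀ i ≤ z.im → ∀ v ∈ Λ i, ∃ u : D.VZ.fiber (σ i z), e i z (D.toRat (σ i z) u) = v)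
    -- the compactification with disc charts at the punctures
    {j : ComplexPoints S → X} (hj : IsEmbedding j) (pt : ι → X) (hpS : ∀ i, pt i ∉ range j)
    (hcov : ∀ x : X, x ∉ range j → ∃ i, x = pt i) (φ : ι → OpenPartialHomeomorph X ℂ) (hp : ∀ i, pt i ∈ (φ i).source)
    (hφp : ∀ i, φ i (pt i) = 0) (hball : ∀ i, Metric.ball (0 : ℂ) (Real.exp (-(2 * Real.pi * A₀ i))) ⊆ (φ i).target)
    (hσ : ∀ (i : ι) (z : ℂ), A₀ i < z.im → j (σ i z) = (φ i).symm (Complex.exp (2 * Real.pi * Complex.I * z))) :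
    CattaniDeligneKaplan1995_hodgeLocus_algebraicFor B D :=
  CattaniDeligneKaplan1995_hodgeLocus_algebraicFor_of_forall_eq_univ_or_finite D fun K =>
    D.toVHSData.hodgeLocusOfNormLe_eq_univ_or_finite_of_lift_of_compactification (natCast_add_self_eq_natCast_two_mul p) K hint
      L Γ hΓ0 hΓan hΓb Λ hΛ hΛT σ e A₀ hF hQ hΛ₁ hΛ₂ hj pt hpS hcov φ hp hφp hball hσ

/-! ## §2 Corollary 1.3 (`r = 1`) over a punctured compact curve, as Zariski closedness on points -/

/-- **Cattani–Deligne–Kaplan, COROLLARY 1.3 for `r = 1` over a PUNCTURED COMPACT CURVE, as Zariski closedness on points** («the set of points in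
`S` where some determination of `u` is of type `(0,0)`, is an algebraic subvariety of `S`»): `D : GeometricVHSData B f n (2p)` over `S(ℂ)`
preconnected, `S` locally of finite type; `u₀ ∈ V_ℤ,s₀`; the FLAT interior charts and flat unipotent puncture charts of the sibling's
`isZariskiClosedOnPoints_determinationLocus_of_charts`, and the compactification with disc charts at the punctures.  Then the set of `t ∈ S(ℂ)`
at which SOME parallel transport `γ · u₀` is of type `(p,p)` is the set of complex points of a Zariski-closed subset of `S`.
[cite: CattaniDeligneKaplan1995, Cor. 1.3 (p. 484), «Proof of 1.5 ⟹ 1.1» (p. 485), 2.3 (p. 487)] [cite: Hartshorne1977, Ch. II Ex. 3.14] -/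
theorem isZariskiClosedOnPoints_determinationLocus_of_compactification [PreconnectedSpace (ComplexPoints S)]
    [LocallyOfFiniteType S.hom] (D : GeometricVHSData B f n (2 * p)) {s₀ : ComplexPoints S} (u₀ : D.VZ.fiber s₀)
    -- flat interior charts at every point
    (hint : ∀ x : ComplexPoints S, ∃ ψ : OpenPartialHomeomorph (ComplexPoints S) ℂ, x ∈ ψ.source ∧
      IsPreconnected ψ.target ∧
      ∃ (e : ∀ c : ℂ, D.V.fiber (ψ.symm c) ≃ₗ[ℚ] V) (H₀ : HodgeStructure V ((2 * p : ℕ) : ℤ)) (P₀ : H₀.Polarization)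
        (h : ℂ → Module.End ℂ (ℂ ⊗[ℚ] V)) (Λ₀ : Submodule ℤ V) (κ : ℝ),
        (∀ (φ : Module.Dual ℂ (ℂ ⊗[ℚ] V)) (w : ℂ ⊗[ℚ] V), AnalyticOnNhd ℂ (fun c => φ (h c w)) ψ.target) ∧
        (∀ c ∈ ψ.target, ((D.hodge (ψ.symm c)).F (p : ℤ)).map ((e c).toLinearMap.baseChange ℂ) =
          (H₀.F (p : ℤ)).comap (h c)) ∧
        Λ₀.FG ∧ (∀ c ∈ ψ.target, ∀ u : D.VZ.fiber (ψ.symm c), e c (D.toRat (ψ.symm c) u) ∈ Λ₀) ∧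
        0 < κ ∧ (∀ c ∈ ψ.target, ∀ x : D.V.fiber (ψ.symm c),
          κ * P₀.hodgeNorm (ofRat (e c x)) ≤ (D.form (ψ.symm c)).hodgeNorm (ofRat x)) ∧
        (∀ c ∈ ψ.target, ∀ c' ∈ ψ.target, ∃ δ : Path.Homotopic.Quotient (ψ.symm c) (ψ.symm c'),
          ∀ y : D.V.fiber (ψ.symm c), e c' (D.V.transport δ y) = e c y))
    -- flat puncture charts
    {ι : Type*} (L : ι → PolarizedLimitMixedHodgeStructure V ((2 * p : ℕ) : ℤ))
    (Γ : ι → ℂ → Module.End ℂ (ℂ ⊗[ℚ] V)) (hΓ0 : ∀ i, Γ i 0 = 0)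
    (hΓan : ∀ (i : ι) (φ : Module.Dual ℂ (ℂ ⊗[ℚ] V)) (w : ℂ ⊗[ℚ] V), AnalyticAt ℂ (fun s => φ (Γ i s w)) 0)
    (hΓb : ∀ (i : ι) (s : ℂ), Γ i s ∈ ⨆ ab ∈ {ab : ℤ × ℤ | ab.1 ≤ -1}, (L i).toMixedHodgeStructure.endPiece ab.1 ab.2)
    (Λ : ι → Submodule ℤ V) (hΛ : ∀ i, (Λ i).FG) (hΛT : ∀ i, ∀ u ∈ Λ i, (L i).monodromy u ∈ Λ i)
    (σ : ι → ℂ → ComplexPoints S) (e : ∀ (i : ι) (z : ℂ), D.V.fiber (σ i z) ≃ₗ[ℚ] V) (A₀ : ι → ℝ)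
    (hF : ∀ (i : ι) (z : ℂ), A₀ i ≤ z.im → ((D.hodge (σ i z)).F (p : ℤ)).map ((e i z).toLinearMap.baseChange ℂ) =
      (((L i).F (p : ℤ)).map (IsNilpotent.exp (Γ i (Complex.exp (2 * Real.pi * Complex.I * z))))).map
        (IsNilpotent.exp (z • (L i).N.baseChange ℂ)))
    (hQ : ∀ (i : ι) (z : ℂ), A₀ i ≤ z.im → ∀ x y : D.V.fiber (σ i z), (D.form (σ i z)).form x y = (L i).Q (e i z x) (e i z y))
    (hΛ₁ : ∀ (i : ι) (z : ℂ), A₀ i ≤ z.im → ∀ u : D.VZ.fiber (σ i z), e i z (D.toRat (σ i z) u) ∈ Λ i)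
    (hflat : ∀ (i : ι) (z z' : ℂ), A₀ i ≤ z.im → A₀ i ≤ z'.im → ∃ δ : Path.Homotopic.Quotient (σ i z) (σ i z'),
      ∀ y : D.V.fiber (σ i z), e i z' (D.V.transport δ y) = e i z y)
    -- the compactification with disc charts at the punctures
    {j : ComplexPoints S → X} (hj : IsEmbedding j) (pt : ι → X) (hpS : ∀ i, pt i ∉ range j)
    (hcov : ∀ x : X, x ∉ range j → ∃ i, x = pt i) (φ : ι → OpenPartialHomeomorph X ℂ) (hp : ∀ i, pt i ∈ (φ i).source)
    (hφp : ∀ i, φ i (pt i) = 0) (hball : ∀ i, Metric.ball (0 : ℂ) (Real.exp (-(2 * Real.pi * A₀ i))) ⊆ (φ i).target)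
    (hσ : ∀ (i : ι) (z : ℂ), A₀ i < z.im → j (σ i z) = (φ i).symm (Complex.exp (2 * Real.pi * Complex.I * z))) :
    IsZariskiClosedOnPoints S
      {t : ComplexPoints S | ∃ γ : Path.Homotopic.Quotient s₀ t, D.IsHodgeAt t (p : ℤ) (D.VZ.transport γ u₀)} :=
  isZariskiClosedOnPoints_of_eq_univ_or_finite
    (D.toVHSData.determinationLocus_eq_univ_or_finite_of_compactification (natCast_add_self_eq_natCast_two_mul p) u₀ hint L Γ
      hΓ0 hΓan hΓb Λ hΛ hΛT σ e A₀ hF hQ hΛ₁ hflat hj pt hpS hcov φ hp hφp hball hσ)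

/-! ## §3 Corollary 1.4 for a rational line (`r = 1`) over a punctured compact curve, as Zariski closedness on points -/

/-- **Cattani–Deligne–Kaplan, COROLLARY 1.4 for a rational LINE, `r = 1`, over a PUNCTURED COMPACT CURVE, as Zariski closedness on points** («The
locus where some flat translate of `U_ℚ` is a Hodge substructure is an algebraic subvariety of `S`» — «suppose first that `U_ℚ` is of dimension
one … `U_ℚ` is a Hodge substructure if and only if `e` is of type `(0,0)`, and one applies 1.3»): for `D`, the charts and the compactification as
in `isZariskiClosedOnPoints_determinationLocus_of_compactification` and an integral `u₀ ≠ 0` at `s₀`, the set of `t ∈ S(ℂ)` such that SOME flat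
translate `γ · (ℚ · u₀) ⊆ V_t` underlies a sub-Hodge structure of the Hodge structure of `V_t` is the set of complex points of a Zariski-closed
subset of `S`. [cite: CattaniDeligneKaplan1995, Cor. 1.4 and its proof (p. 486), Cor. 1.3 (p. 484)] [cite: Hartshorne1977, Ch. II Ex. 3.14] -/
theorem isZariskiClosedOnPoints_translateLocus_line_of_compactification [PreconnectedSpace (ComplexPoints S)]
    [LocallyOfFiniteType S.hom] (D : GeometricVHSData B f n (2 * p)) {s₀ : ComplexPoints S} {u₀ : D.VZ.fiber s₀} (hu₀ : u₀ ≠ 0)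
    -- flat interior charts at every point
    (hint : ∀ x : ComplexPoints S, ∃ ψ : OpenPartialHomeomorph (ComplexPoints S) ℂ, x ∈ ψ.source ∧
      IsPreconnected ψ.target ∧
      ∃ (e : ∀ c : ℂ, D.V.fiber (ψ.symm c) ≃ₗ[ℚ] V) (H₀ : HodgeStructure V ((2 * p : ℕ) : ℤ)) (P₀ : H₀.Polarization)
        (h : ℂ → Module.End ℂ (ℂ ⊗[ℚ] V)) (Λ₀ : Submodule ℤ V) (κ : ℝ),
        (∀ (φ : Module.Dual ℂ (ℂ ⊗[ℚ] V)) (w : ℂ ⊗[ℚ] V), AnalyticOnNhd ℂ (fun c => φ (h c w)) ψ.target) ∧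
        (∀ c ∈ ψ.target, ((D.hodge (ψ.symm c)).F (p : ℤ)).map ((e c).toLinearMap.baseChange ℂ) =
          (H₀.F (p : ℤ)).comap (h c)) ∧
        Λ₀.FG ∧ (∀ c ∈ ψ.target, ∀ u : D.VZ.fiber (ψ.symm c), e c (D.toRat (ψ.symm c) u) ∈ Λ₀) ∧
        0 < κ ∧ (∀ c ∈ ψ.target, ∀ x : D.V.fiber (ψ.symm c),
          κ * P₀.hodgeNorm (ofRat (e c x)) ≤ (D.form (ψ.symm c)).hodgeNorm (ofRat x)) ∧
        (∀ c ∈ ψ.target, ∀ c' ∈ ψ.target, ∃ δ : Path.Homotopic.Quotient (ψ.symm c) (ψ.symm c'),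
          ∀ y : D.V.fiber (ψ.symm c), e c' (D.V.transport δ y) = e c y))
    -- flat puncture charts
    {ι : Type*} (L : ι → PolarizedLimitMixedHodgeStructure V ((2 * p : ℕ) : ℤ))
    (Γ : ι → ℂ → Module.End ℂ (ℂ ⊗[ℚ] V)) (hΓ0 : ∀ i, Γ i 0 = 0)
    (hΓan : ∀ (i : ι) (φ : Module.Dual ℂ (ℂ ⊗[ℚ] V)) (w : ℂ ⊗[ℚ] V), AnalyticAt ℂ (fun s => φ (Γ i s w)) 0)
    (hΓb : ∀ (i : ι) (s : ℂ), Γ i s ∈ ⨆ ab ∈ {ab : ℤ × ℤ | ab.1 ≤ -1}, (L i).toMixedHodgeStructure.endPiece ab.1 ab.2)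
    (Λ : ι → Submodule ℤ V) (hΛ : ∀ i, (Λ i).FG) (hΛT : ∀ i, ∀ u ∈ Λ i, (L i).monodromy u ∈ Λ i)
    (σ : ι → ℂ → ComplexPoints S) (e : ∀ (i : ι) (z : ℂ), D.V.fiber (σ i z) ≃ₗ[ℚ] V) (A₀ : ι → ℝ)
    (hF : ∀ (i : ι) (z : ℂ), A₀ i ≤ z.im → ((D.hodge (σ i z)).F (p : ℤ)).map ((e i z).toLinearMap.baseChange ℂ) =
      (((L i).F (p : ℤ)).map (IsNilpotent.exp (Γ i (Complex.exp (2 * Real.pi * Complex.I * z))))).map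
        (IsNilpotent.exp (z • (L i).N.baseChange ℂ)))
    (hQ : ∀ (i : ι) (z : ℂ), A₀ i ≤ z.im → ∀ x y : D.V.fiber (σ i z), (D.form (σ i z)).form x y = (L i).Q (e i z x) (e i z y))
    (hΛ₁ : ∀ (i : ι) (z : ℂ), A₀ i ≤ z.im → ∀ u : D.VZ.fiber (σ i z), e i z (D.toRat (σ i z) u) ∈ Λ i)
    (hflat : ∀ (i : ι) (z z' : ℂ), A₀ i ≤ z.im → A₀ i ≤ z'.im → ∃ δ : Path.Homotopic.Quotient (σ i z) (σ i z'),
      ∀ y : D.V.fiber (σ i z), e i z' (D.V.transport δ y) = e i z y)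
    -- the compactification with disc charts at the punctures
    {j : ComplexPoints S → X} (hj : IsEmbedding j) (pt : ι → X) (hpS : ∀ i, pt i ∉ range j)
    (hcov : ∀ x : X, x ∉ range j → ∃ i, x = pt i) (φ : ι → OpenPartialHomeomorph X ℂ) (hp : ∀ i, pt i ∈ (φ i).source)
    (hφp : ∀ i, φ i (pt i) = 0) (hball : ∀ i, Metric.ball (0 : ℂ) (Real.exp (-(2 * Real.pi * A₀ i))) ⊆ (φ i).target)
    (hσ : ∀ (i : ι) (z : ℂ), A₀ i < z.im → j (σ i z) = (φ i).symm (Complex.exp (2 * Real.pi * Complex.I * z))) :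
    IsZariskiClosedOnPoints S
      {t : ComplexPoints S | ∃ γ : Path.Homotopic.Quotient s₀ t, ∃ W : HodgeStructure.SubHodgeStructure (D.hodge t),
        W.toSubmodule = (ℚ ∙ D.toRat s₀ u₀).map (D.V.transport γ)} := by
  haveI : ∀ s : ComplexPoints S, Module.Finite ℚ (D.V.fiber s) := fun s => D.toVHSData.finite_fiber s
  have heq := D.toVHSData.translateLocus_line_eq_determinationLocus s₀ hu₀ (natCast_add_self_eq_natCast_two_mul p)
  have hZ := isZariskiClosedOnPoints_determinationLocus_of_compactification D u₀ hint L Γ hΓ0 hΓan hΓb Λ hΛ hΛT σ e A₀ hF hQ hΛ₁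
    hflat hj pt hpS hcov φ hp hφp hball hσ
  rw [heq]
  exact hZ

/-! ## §4 Corollary 1.4 for a rational subspace of ANY dimension (`r = 1`) over a punctured compact curve, as Zariski closedness on points -/

/-- **Cattani–Deligne–Kaplan, COROLLARY 1.4 for a rational subspace `U_ℚ ⊆ V_{s₀}` of ANY dimension `d`, `r = 1`, over a PUNCTURED COMPACT CURVE,
as Zariski closedness on points** («Consider now the general case: `U` of dimension `n`. … This amounts to … `⋀ⁿ U_ℚ` being a Hodge substructure of
`⋀ⁿ H_ℚ`, and reduces us to the one-dimensional case, proving 1.4»): for a geometric VHS datum `D` of weight `w` on `S(ℂ)` (preconnected),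
`U ⊆ V_{s₀}` rational of dimension `d`, `P + P = d·w`, and FOR THE EXTERIOR-POWER DATUM `⋀ᵈ D` (`VHSData.exteriorPower`) the charts and the
compactification of `isZariskiClosedOnPoints_determinationLocus_of_compactification`, the set of `t ∈ S(ℂ)` such that SOME flat translate
`γ · U ⊆ V_t` underlies a sub-Hodge structure of the Hodge structure of `V_t` is the set of complex points of a Zariski-closed subset of `S` (it is
all of `S(ℂ)` or finite: `VHSData.translateLocus_eq_univ_or_finite_of_compactification`).
[cite: CattaniDeligneKaplan1995, Cor. 1.4 and its proof (p. 486), Cor. 1.3 (p. 484)] [cite: Hartshorne1977, Ch. II Ex. 3.14] -/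
theorem isZariskiClosedOnPoints_translateLocus_of_compactification [PreconnectedSpace (ComplexPoints S)] [LocallyOfFiniteType S.hom] {w : ℕ}
    (D : GeometricVHSData B f n w) {d : ℕ} {P : ℤ} (hP : P + P = d * (w : ℤ)) {s₀ : ComplexPoints S} {U : Submodule ℚ (D.V.fiber s₀)}
    (hd : Module.finrank ℚ U = d)
    -- flat interior charts for `⋀ᵈ D` at every point
    (hint : ∀ x : ComplexPoints S, ∃ ψ : OpenPartialHomeomorph (ComplexPoints S) ℂ, x ∈ ψ.source ∧ IsPreconnected ψ.target ∧
      ∃ (e : ∀ c : ℂ, (D.toVHSData.exteriorPower d).V.fiber (ψ.symm c) ≃ₗ[ℚ] V) (H₀ : HodgeStructure V (d * (w : ℤ))) (P₀ : H₀.Polarization)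
        (h : ℂ → Module.End ℂ (ℂ ⊗[ℚ] V)) (Λ₀ : Submodule ℤ V) (κ : ℝ),
        (∀ (φ : Module.Dual ℂ (ℂ ⊗[ℚ] V)) (w : ℂ ⊗[ℚ] V), AnalyticOnNhd ℂ (fun c => φ (h c w)) ψ.target) ∧
        (∀ c ∈ ψ.target, (((D.toVHSData.exteriorPower d).hodge (ψ.symm c)).F P).map ((e c).toLinearMap.baseChange ℂ) = (H₀.F P).comap (h c)) ∧
        Λ₀.FG ∧ (∀ c ∈ ψ.target, ∀ u : (D.toVHSData.exteriorPower d).VZ.fiber (ψ.symm c),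
          e c ((D.toVHSData.exteriorPower d).toRat (ψ.symm c) u) ∈ Λ₀) ∧
        0 < κ ∧ (∀ c ∈ ψ.target, ∀ x : (D.toVHSData.exteriorPower d).V.fiber (ψ.symm c),
          κ * P₀.hodgeNorm (ofRat (e c x)) ≤ ((D.toVHSData.exteriorPower d).form (ψ.symm c)).hodgeNorm (ofRat x)) ∧
        (∀ c ∈ ψ.target, ∀ c' ∈ ψ.target, ∃ δ : Path.Homotopic.Quotient (ψ.symm c) (ψ.symm c'),
          ∀ y : (D.toVHSData.exteriorPower d).V.fiber (ψ.symm c), e c' ((D.toVHSData.exteriorPower d).V.transport δ y) = e c y))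
    -- flat puncture charts for `⋀ᵈ D`
    {ι : Type*} (L : ι → PolarizedLimitMixedHodgeStructure V (d * (w : ℤ))) (Γ : ι → ℂ → Module.End ℂ (ℂ ⊗[ℚ] V))
    (hΓ0 : ∀ i, Γ i 0 = 0)
    (hΓan : ∀ (i : ι) (φ : Module.Dual ℂ (ℂ ⊗[ℚ] V)) (w : ℂ ⊗[ℚ] V), AnalyticAt ℂ (fun s => φ (Γ i s w)) 0)
    (hΓb : ∀ (i : ι) (s : ℂ), Γ i s ∈ ⨆ ab ∈ {ab : ℤ × ℤ | ab.1 ≤ -1}, (L i).toMixedHodgeStructure.endPiece ab.1 ab.2)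
    (Λ : ι → Submodule ℤ V) (hΛ : ∀ i, (Λ i).FG) (hΛT : ∀ i, ∀ u ∈ Λ i, (L i).monodromy u ∈ Λ i)
    (σ : ι → ℂ → ComplexPoints S) (e : ∀ (i : ι) (z : ℂ), (D.toVHSData.exteriorPower d).V.fiber (σ i z) ≃ₗ[ℚ] V) (A₀ : ι → ℝ)
    (hF : ∀ (i : ι) (z : ℂ), A₀ i ≤ z.im →
      (((D.toVHSData.exteriorPower d).hodge (σ i z)).F P).map ((e i z).toLinearMap.baseChange ℂ) =
        (((L i).F P).map (IsNilpotent.exp (Γ i (Complex.exp (2 * Real.pi * Complex.I * z))))).map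
          (IsNilpotent.exp (z • (L i).N.baseChange ℂ)))
    (hQ : ∀ (i : ι) (z : ℂ), A₀ i ≤ z.im → ∀ x y : (D.toVHSData.exteriorPower d).V.fiber (σ i z),
      ((D.toVHSData.exteriorPower d).form (σ i z)).form x y = (L i).Q (e i z x) (e i z y))
    (hΛ₁ : ∀ (i : ι) (z : ℂ), A₀ i ≤ z.im → ∀ u : (D.toVHSData.exteriorPower d).VZ.fiber (σ i z),
      e i z ((D.toVHSData.exteriorPower d).toRat (σ i z) u) ∈ Λ i)
    (hflat : ∀ (i : ι) (z z' : ℂ), A₀ i ≤ z.im → A₀ i ≤ z'.im → ∃ δ : Path.Homotopic.Quotient (σ i z) (σ i z'),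
      ∀ y : (D.toVHSData.exteriorPower d).V.fiber (σ i z), e i z' ((D.toVHSData.exteriorPower d).V.transport δ y) = e i z y)
    -- the compactification with disc charts at the punctures
    {j : ComplexPoints S → X} (hj : IsEmbedding j) (pt : ι → X) (hpS : ∀ i, pt i ∉ range j)
    (hcov : ∀ x : X, x ∉ range j → ∃ i, x = pt i) (φ : ι → OpenPartialHomeomorph X ℂ) (hp : ∀ i, pt i ∈ (φ i).source)
    (hφp : ∀ i, φ i (pt i) = 0) (hball : ∀ i, Metric.ball (0 : ℂ) (Real.exp (-(2 * Real.pi * A₀ i))) ⊆ (φ i).target)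
    (hσ : ∀ (i : ι) (z : ℂ), A₀ i < z.im → j (σ i z) = (φ i).symm (Complex.exp (2 * Real.pi * Complex.I * z))) :
    IsZariskiClosedOnPoints S
      {t : ComplexPoints S | ∃ γ : Path.Homotopic.Quotient s₀ t, ∃ W : HodgeStructure.SubHodgeStructure (D.hodge t),
        W.toSubmodule = U.map (D.V.transport γ)} :=
  isZariskiClosedOnPoints_of_eq_univ_or_finite
    (D.toVHSData.translateLocus_eq_univ_or_finite_of_compactification hP hd hint L Γ hΓ0 hΓan hΓb Λ hΛ hΛT σ e A₀ hF hQ hΛ₁ hflat hj pt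
      hpS hcov φ hp hφp hball hσ)

end Literature.Barriers.HodgeConjecture

end
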